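import Literature.MathematicalPhysics.QuantumLattice.FermiRG.BGM2006Sec2IsoDecayProof
import Literature.MathematicalPhysics.QuantumLattice.FermiRG.BGM2006Sec2TangentialBudget
import HarnessLib

/-!
# Benfatto–Giuliani–Mastropietro 2006, Lemma 2.2 (2.52): decay of the anisotropic single-scale sector
propagators for a scale-dependent dispersion — proof

Topic `Literature/MathematicalPhysics/QuantumLattice/FermiRG`; the proof file behind the named fact
`BGM2006_Lemma_2_2` of `BGM2006Sec2Setup.lean` (source BGM06 = G. Benfatto, A. Giuliani, V. Mastropietro,
*Fermi liquid behavior in the 2D Hubbard model at low temperatures*, Ann. Henri Poincaré **7** (2006)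
809–898, arXiv:cond-mat/0507686; locators `p00NN:Lnn` = chunk/line of the `lit read` render of the arXiv
TeX), after `BGM2006Sec2IsoDecayProof` (the isotropic normal form of the decay for every angular index,
Lemma 2.3) and `BGM2006Sec2TangentialBudget` (the tangential derivative budget (2.53)–(2.55)).

## The printed proof and this file

BGM (p0010:L129–p0011:L22) prove (2.52),
`|g^{(h)}_ω(x)| ≤ C_N γ^{3h/2} / (1 + (γ^h|d_β(x₀)| + γ^h|x'₁|)^N + γ^{-h}(γ^h|x'₂|)^N)`,
`x'₁ = x⃗·n⃗_h(θ_{h,ω})`, `x'₂ = x⃗·τ⃗_h(θ_{h,ω})` (2.51), by integrating by parts in (2.49): the measure of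
the support of `F_{h,ω}` is `O(γ^h · γ^h · γ^{h/2})`, the integrand is `O(γ^{-h})` — the dimensional bound
`Cγ^{3h/2}` (2.50) — and "each derivative with respect to `k₀` or `k'₁` produces an extra factor
`γ^{-h}`" (summation by parts in `k₀` gives `d_β(x₀)`, (2.36c)), while in the tangential direction
"`∂^N_{k'₂}[F_{h,ω}(k)/(-ik₀ + E_{h-1}(k) - μ)] = O(γ^{-Nh})`, `N ≥ 2`" (2.55) — only `γ^{-Nh}` in
total although the support is `γ^{h/2}` wide, because the Fermi point of the sector centre is a critical
point of `ε_h` along `τ⃗` ((2.53)–(2.54)).  Here: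

* the `k₀` and `k'₁` sides are READ from `BGM2006Sec2IsoDecayProof.exists_decay_bgmGenProp` at the
  anisotropic angular index `m = n(h)` (`w_n = πγ^{h/2} ≥ γ^h`): its isotropic normal form
  `|g| ≤ K γ^h w_n / (1 + (γ^h|d_β| + γ^h|x⃗|)^N)` has `γ^h w_n = πγ^{3h/2}` and `|x⃗| ≥ |x'₁|`
  (`n⃗_h` is a unit vector, `BGM2006Sec2AnisoSupport.dot2_polarNormal_sq_add_dot2_polarTangent_sq`), so it
  already dominates the first two terms of the printed denominator — BGM's `k'₁`-integration by parts is
  the `γ^h`-isotropic one;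
* §1 `exists_norm_iteratedFDeriv_bgmSliceE2_tangent_le`: the sup of the `N`-th directional derivative of
  the period-cell slice `1_B F_{h,ω}(k₀,·)/D_{h-1}(k₀,·)` (`bgmSliceE2` of `BGM2006Sec2IsoDecayProof`) in the
  direction `τ⃗_h(θ_{n,ω})` is `≤ K γ^{-h} (γ^{h/2})^{min(N,2)} γ^{-Nh}` — the export (2.55)
  `exists_norm_iteratedDeriv_bgmSurrogateIntegrand_tangent_le` of `BGM2006Sec2TangentialBudget` read through
  the line-restriction frame of the isotropic file (on the support disc the slice is `γ^{-h}Φ̃`, off the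
  support all derivatives vanish);
* §2 `exists_tanpow_mul_norm_bgmGenProp_le`: `N` integrations by parts along `τ⃗` per Matsubara frequency
  (`pow_dot_mul_norm_sliceIntegral_le`, direction-agnostic), the `L¹` norm of the derivative by the polar
  support lemma (`integral_norm_iteratedFDeriv_bgmSliceE2_le_of_bound`: sup times the measure
  `≲ w_n e₀γ^h/c` of the window), and the frequency count `(1/β)#{|k₀| ≤ 8e₀γ^h} ≤ 32e₀γ^h/π`:
  `(γ^h|x'₂|)^N |g^{(h)}_ω(x)| ≤ K γ^h w_n (γ^{h/2})^{min(N,2)}`;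
* §3 `BGM2006_Lemma_2_2_holds`: for `N ≥ 2`, `(γ^{h/2})^{min(N,2)} = γ^h`, so §2 is
  `γ^{-h}(γ^h|x'₂|)^N|g| ≤ πK γ^{3h/2}`; added to the isotropic normal form this is (2.52) with the
  printed denominator (the smallness constant is the minimum of the two coupled-smallness constants, the
  `|U| ≤ U₀`, `|h_β|U₀ ≤ c₀` bookkeeping is `bgmSmoothness_wlog`).

Everything here is PROVED; no definitions, no named facts, no `sorry`, no instances, no notation.

## Sources

* [BGM06] G. Benfatto, A. Giuliani, V. Mastropietro, Ann. Henri Poincaré 7 (2006) 809–898,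
  arXiv:cond-mat/0507686, §2.5 (2.45)–(2.49), Lemma 2.2 (2.51)–(2.52) and its proof (2.53)–(2.55)
  p0010:L107–p0011:L22; §2.4 (2.42)–(2.42a); §2.3 (2.36c). [BenfattoGiulianiMastropietro2006]
-/

noncomputable section

open Real Set Filter MeasureTheory Literature.Analysis.Calculus Literature.Analysis.SpecialFunctions
open scoped Topology FourierTransform

namespace Literature.MathematicalPhysics.QuantumLattice.FermiRG

/-! ### §1 The sup of the tangential directional derivatives of the slice -/

/-- **The tangential directional derivatives of the slice are `O(γ^{-h}(γ^{h/2})^{min(N,2)}γ^{-Nh})`,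
uniformly**: for the anisotropic index `n(h)` and the unit tangent `τ⃗ = τ⃗_h(θ_{n,ω})` of the sector
centre, `‖D^N(1_B F_{h,ω}/D_{h-1})(x)(τ⃗,…,τ⃗)‖ ≤ K 4^{-h} (2^h)^{min(N,2)} (4^{-h})^N` at every point `x` of
the plane — on the support disc the slice is `γ^{-h}Φ̃` and (2.55) applies along the line `x + sτ⃗`, off
the support all derivatives vanish. [cite: BenfattoGiulianiMastropietro2006, §2.5 proof of Lemma 2.2 (2.53)–(2.55) p0010:L129–p0011:L22] -/
theorem exists_norm_iteratedFDeriv_bgmSliceE2_tangent_le {μ e₀ : ℝ} (hμ₁ : -4 < μ) (he : 0 < e₀)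
    (he4 : e₀ < μ + 4) (C : ℕ → ℝ) (N : ℕ) (c₀ : ℝ) :
    ∃ K : ℝ, 0 ≤ K ∧ ∀ (β U : ℝ) (hβ : ℤ) (E : ℤ → ℝ × (Fin 2 → ℝ) → ℂ), 0 < β →
      BGMInitial E → BGMSymmetry E → BGMSmoothness β U C hβ E → |U| ≤ c₀ → |U| * |(hβ : ℝ)| ≤ c₀ →
      |C 0| * c₀ ≤ 3 / 16 * e₀ → 2 * |C 1| * c₀ ^ 2 ≤ 1 / 2 →
      2 * (4 * |C 2| * c₀ ^ 2) * (2 * |C 0| * c₀ + 2 * e₀) ≤ 1 →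
      μ + e₀ + 2 * |C 0| * c₀ < -2 - Real.sqrt 2 → 2 * |C 0| * c₀ ≤ (μ + 4 - e₀) / 2 →
      2 * (2 * |C 1| * c₀ ^ 2) ≤ 2 / π * Real.sqrt ((μ + 4 - e₀) / 2) →
      ∀ h : ℤ, hβ ≤ h → h ≤ 0 → ∀ (ω : ℕ) (j : ℤ) (x : EuclideanSpace ℝ (Fin 2)),
      ‖iteratedFDeriv ℝ N (bgmSliceE2 μ e₀ E h (bgmScaleIdx h) ω (fermiMatsubara β j)) x
          (fun _ => WithLp.toLp 2 (polarTangent (levelRadius (bgmEffDisp β E h) μ)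
            (sectorCenter (bgmScaleIdx h) ω)))‖ ≤
        K * ((4 : ℝ) ^ (-h) * (((2 : ℝ) ^ h) ^ min N 2 * ((4 : ℝ) ^ (-h)) ^ N)) := by
  obtain ⟨K, hK0, hK⟩ := exists_norm_iteratedDeriv_bgmSurrogateIntegrand_tangent_le (μ := μ) hμ₁ he he4 C N c₀
  refine ⟨K, hK0, fun β U hβ E hβpos hI hSy hS hU hUh hK₀ hK₁ hK₂' hgap hgap' hδ₁ h hh₁ hh₀ ω j x => ?_⟩
  have hπ := Real.pi_pos
  have hππ : 0 < π ^ 2 := by positivity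
  have h4' : (0 : ℝ) < (4 : ℝ) ^ (-h) := zpow_pos (by norm_num) _
  have h2 : (0 : ℝ) < (2 : ℝ) ^ h := zpow_pos (by norm_num) _
  have hscale : 0 ≤ K * ((4 : ℝ) ^ (-h) * (((2 : ℝ) ^ h) ^ min N 2 * ((4 : ℝ) ^ (-h)) ^ N)) := by positivity
  set τ : Fin 2 → ℝ := polarTangent (levelRadius (bgmEffDisp β E h) μ) (sectorCenter (bgmScaleIdx h) ω) with hτ
  set v : EuclideanSpace ℝ (Fin 2) := WithLp.toLp 2 τ with hv
  -- the smooth slice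
  have hf : ContDiff ℝ N (bgmSliceE2 μ e₀ E h (bgmScaleIdx h) ω (fermiMatsubara β j)) :=
    contDiff_bgmSliceE2 hI hS he he4 hh₁ hh₀ hU hUh hμ₁ hK₀ hgap hgap' _ _ j
  by_cases hx : x ∈ tsupport (bgmSliceE2 μ e₀ E h (bgmScaleIdx h) ω (fermiMatsubara β j))
  · -- on the support: `|x| ≤ π/4`, the point lies in the disc `B` and has small coordinates
    have hball := tsupport_bgmSliceE2_subset_closedBall hI hS he hh₁ hh₀ hU hUh hμ₁ hK₀ hgap _ _ j hx
    rw [Metric.mem_closedBall, dist_zero_right] at hball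
    obtain ⟨q, hq⟩ : ∃ q : Fin 2 → ℝ, q = WithLp.ofLp x := ⟨_, rfl⟩
    have hn : ‖x‖ ^ 2 = q 0 ^ 2 + q 1 ^ 2 := by
      rw [EuclideanSpace.real_norm_sq_eq, Fin.sum_univ_two, hq]
    have hqsq : q 0 ^ 2 + q 1 ^ 2 ≤ (π / 4) ^ 2 := by
      rw [← hn]; exact pow_le_pow_left₀ (norm_nonneg _) hball 2
    have hqB : q ∈ {q : Fin 2 → ℝ | q 0 ^ 2 + q 1 ^ 2 < (3 * π / 4) ^ 2} := by
      simp only [Set.mem_setOf_eq]; nlinarith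
    have hq7 : ∀ i, |q i| < 7 * π / 4 := by
      have h0 : q 0 ^ 2 < (7 * π / 4) ^ 2 := by nlinarith [sq_nonneg (q 1)]
      have h1 : q 1 ^ 2 < (7 * π / 4) ^ 2 := by nlinarith [sq_nonneg (q 0)]
      rw [Fin.forall_fin_two]
      exact ⟨abs_lt_of_sq_lt_sq h0 (by positivity), abs_lt_of_sq_lt_sq h1 (by positivity)⟩
    have hopen : IsOpen {q : Fin 2 → ℝ | q 0 ^ 2 + q 1 ^ 2 < (3 * π / 4) ^ 2} :=
      isOpen_lt (by fun_prop) continuous_const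
    -- the line restriction
    have hline := iteratedDeriv_lineRestriction hf x v 0
    rw [zero_smul, add_zero] at hline
    rw [← hline]
    -- near `s = 0` the line restriction is `γ^{-h} Φ̃(k₀, q + s τ)`
    have hB0 : {q : Fin 2 → ℝ | q 0 ^ 2 + q 1 ^ 2 < (3 * π / 4) ^ 2} ∈ 𝓝 (q + (0 : ℝ) • τ) := by
      rw [zero_smul, add_zero]; exact hopen.mem_nhds hqB
    have hev0 : ∀ᶠ s : ℝ in 𝓝 0, q + s • τ ∈ {q : Fin 2 → ℝ | q 0 ^ 2 + q 1 ^ 2 < (3 * π / 4) ^ 2} :=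
      (by fun_prop : Continuous fun s : ℝ => q + s • τ).continuousAt.preimage_mem_nhds hB0
    have hev : (fun s : ℝ => bgmSliceE2 μ e₀ E h (bgmScaleIdx h) ω (fermiMatsubara β j) (x + s • v)) =ᶠ[𝓝 0]
        fun s : ℝ => (((4 : ℝ) ^ (-h) : ℝ) : ℂ) *
          bgmSurrogateIntegrand μ e₀ (Real.sqrt ((μ + 4 - e₀) / 2) / 2) E h (bgmScaleIdx h) ω
            (fermiMatsubara β j, q + s • τ) := by
      filter_upwards [hev0] with s hs
      have hxs : WithLp.ofLp (x + s • v) = q + s • τ := by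
        rw [WithLp.ofLp_add, WithLp.ofLp_smul, hq, hv, WithLp.ofLp_toLp]
      rw [bgmSliceE2, hxs, bgmSliceFn_eq_indicator_surrogate hI hS he he4 hh₁ hh₀ hU hUh hK₀ hgap',
        Set.indicator_of_mem (show q + s • τ ∈ {q : Fin 2 → ℝ | q 0 ^ 2 + q 1 ^ 2 < (3 * π / 4) ^ 2} from hs)]
    rw [hev.iteratedDeriv_eq]
    have hG : ContDiff ℝ N fun s : ℝ => bgmSurrogateIntegrand μ e₀ (Real.sqrt ((μ + 4 - e₀) / 2) / 2) E h
        (bgmScaleIdx h) ω (fermiMatsubara β j, q + s • τ) :=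
      contDiff_lineRestriction (contDiff_bgmSurrogateIntegrand_slice hS he (by positivity) μ _ h _ _) q τ
    rw [iteratedDeriv_const_mul _ hG.contDiffAt, norm_mul, Complex.norm_real, Real.norm_eq_abs, abs_of_pos h4']
    have hKN := hK β U hβ E hβpos hI hSy hS hU hUh hK₀ hK₁ hK₂' hgap hgap' hδ₁ h hh₁ hh₀ ω j q hq7 N le_rfl
    calc (4 : ℝ) ^ (-h) * ‖iteratedDeriv N (fun s : ℝ => bgmSurrogateIntegrand μ e₀
          (Real.sqrt ((μ + 4 - e₀) / 2) / 2) E h (bgmScaleIdx h) ω (fermiMatsubara β j, q + s • τ)) 0‖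
        ≤ (4 : ℝ) ^ (-h) * (K * ((2 : ℝ) ^ h) ^ min N 2 * ((4 : ℝ) ^ (-h)) ^ N) :=
          mul_le_mul_of_nonneg_left hKN h4'.le
      _ = K * ((4 : ℝ) ^ (-h) * (((2 : ℝ) ^ h) ^ min N 2 * ((4 : ℝ) ^ (-h)) ^ N)) := by ring
  · -- off the support all derivatives vanish
    have h0 : iteratedFDeriv ℝ N (bgmSliceE2 μ e₀ E h (bgmScaleIdx h) ω (fermiMatsubara β j)) x = 0 := by
      by_contra hne
      exact hx (support_iteratedFDeriv_subset N (Function.mem_support.2 hne))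
    rw [h0]
    simpa using hscale

/-! ### §2 The tangential decay of the anisotropic sector propagator -/

/-- **The frequency count, uniform in `β`**: if every `j ∈ S` has `|k₀(j)| ≤ R` then `(1/β)·#S ≤ 4R/π`.
[cite: BenfattoGiulianiMastropietro2006, §2.3 (2.31a) p0007:L137] -/
private theorem inv_beta_mul_card_le_tan {β R : ℝ} (hβ : 0 < β) (hR : 0 ≤ R) (S : Finset ℤ)
    (hS : ∀ j ∈ S, |fermiMatsubara β j| ≤ R) : 1 / β * (S.card : ℝ) ≤ 4 * R / π := by
  rcases S.eq_empty_or_nonempty with hSe | ⟨j, hj⟩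
  · rw [hSe, Finset.card_empty, Nat.cast_zero, mul_zero]; positivity
  · have h1 : π / β ≤ R := (pi_div_le_abs_fermiMatsubara hβ j).trans (hS j hj)
    have hcard := card_fermiMatsubara_le hβ hR S hS
    have h3 : (3 : ℝ) ≤ 3 * (R * β / π) := by
      rw [div_le_iff₀ hβ] at h1
      have : 1 ≤ R * β / π := by rw [le_div_iff₀ Real.pi_pos]; linarith
      linarith
    have h4 : (S.card : ℝ) ≤ 4 * (R * β / π) := by linarith
    calc 1 / β * (S.card : ℝ) ≤ 1 / β * (4 * (R * β / π)) :=
          mul_le_mul_of_nonneg_left h4 (by positivity)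
      _ = 4 * R / π := by field_simp

/-- A finite Matsubara box containing every frequency with `|k₀| ≤ R`, all of whose members satisfy
`|k₀| ≤ R`. [folklore] -/
private theorem exists_matsubara_box_tan {β : ℝ} (hβ : 0 < β) (R : ℝ) :
    ∃ S : Finset ℤ, (∀ j ∈ S, |fermiMatsubara β j| ≤ R) ∧ (∀ j, |fermiMatsubara β j| ≤ R → j ∈ S) := by
  refine ⟨(Finset.Icc (-(⌈R * β / (2 * π)⌉₊ : ℤ)) (⌈R * β / (2 * π)⌉₊ : ℤ)).filter
      fun j => |fermiMatsubara β j| ≤ R,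
    fun j hj => (Finset.mem_filter.1 hj).2, fun j hj => ?_⟩
  exact Finset.mem_filter.2 ⟨natAbs_le_of_abs_fermiMatsubara_le hβ hj, hj⟩

/-- **The tangential decay of the anisotropic sector propagator (2.49), every scale, uniformly in `β`**:
under (2.36) with the coupled smallness, for the anisotropic angular index `n(h)`, every sector and every
`N`: `(γ^h|x⃗·τ⃗_h(θ_{n,ω})|)^N |g^{(h)}_ω(x₀, x⃗)| ≤ K γ^h w_n (γ^{h/2})^{min(N,2)}` — `N` integrations by
parts along `τ⃗` per frequency against the `L¹` norm of the `N`-th tangential derivative of the slice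
(sup (2.55) times the measure of the support window), summed over the `O(βe₀γ^h)` frequencies of the
support. [cite: BenfattoGiulianiMastropietro2006, §2.5 proof of Lemma 2.2 (2.50)–(2.55) p0010:L129–p0011:L22] -/
theorem exists_tanpow_mul_norm_bgmGenProp_le {μ e₀ : ℝ} (hμ₁ : -4 < μ) (he : 0 < e₀) (he4 : e₀ < μ + 4)
    (C : ℕ → ℝ) (N : ℕ) (c₀ : ℝ) :
    ∃ K : ℝ, 0 ≤ K ∧ ∀ (β U : ℝ) (hβ : ℤ) (E : ℤ → ℝ × (Fin 2 → ℝ) → ℂ), 0 < β →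
      BGMInitial E → BGMSymmetry E → BGMSmoothness β U C hβ E → |U| ≤ c₀ → |U| * |(hβ : ℝ)| ≤ c₀ →
      |C 0| * c₀ ≤ 3 / 16 * e₀ → 2 * |C 1| * c₀ ^ 2 ≤ 1 / 2 →
      2 * (4 * |C 2| * c₀ ^ 2) * (2 * |C 0| * c₀ + 2 * e₀) ≤ 1 →
      μ + e₀ + 2 * |C 0| * c₀ < -2 - Real.sqrt 2 → 2 * |C 0| * c₀ ≤ (μ + 4 - e₀) / 2 →
      2 * (2 * |C 1| * c₀ ^ 2) ≤ 2 / π * Real.sqrt ((μ + 4 - e₀) / 2) →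
      ∀ h : ℤ, hβ ≤ h → h ≤ 0 → ∀ ω : ℕ, ω < sectorCount (bgmScaleIdx h) →
      ∀ (x₀ : ℝ) (x : Fin 2 → ℤ),
      ((4 : ℝ) ^ h * |dot2 (fun i => (x i : ℝ))
          (polarTangent (levelRadius (bgmEffDisp β E h) μ) (sectorCenter (bgmScaleIdx h) ω))|) ^ N *
        ‖bgmGenProp β e₀ μ E h (bgmScaleIdx h) ω x₀ x‖ ≤
        K * (4 : ℝ) ^ h * sectorWidth (bgmScaleIdx h) * ((2 : ℝ) ^ h) ^ min N 2 := by
  have hπ := Real.pi_pos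
  obtain ⟨c, hc⟩ : ∃ c : ℝ, c = Real.sqrt ((μ + 4 - e₀) / 2) := ⟨_, rfl⟩
  have hcpos : 0 < c := by rw [hc]; exact Real.sqrt_pos.2 (by linarith)
  obtain ⟨Ks, hKs0, hKs⟩ := exists_norm_iteratedFDeriv_bgmSliceE2_tangent_le hμ₁ he he4 C N c₀
  obtain ⟨KL, hKL⟩ : ∃ KL : ℝ, KL = 6 * (3 / 4) * (π / 4) * Ks * (2 * (e₀ / (2 / π * c))) := ⟨_, rfl⟩
  have hKL0 : 0 ≤ KL := by rw [hKL]; positivity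
  refine ⟨32 * e₀ / π * KL / (2 * π) ^ 2, by positivity,
    fun β U hβ E hβpos hI hSy hS hU hUh hK₀ hK₁ hK₂' hgap hgap' hδ₁ h hh₁ hh₀ ω hω x₀ x => ?_⟩
  have h4 : (0 : ℝ) < (4 : ℝ) ^ h := zpow_pos (by norm_num) _
  have h4' : (0 : ℝ) < (4 : ℝ) ^ (-h) := zpow_pos (by norm_num) _
  have h2 : (0 : ℝ) < (2 : ℝ) ^ h := zpow_pos (by norm_num) _
  have hw := sectorWidth_pos (bgmScaleIdx h)
  set n : ℕ := bgmScaleIdx h with hn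
  set τ : Fin 2 → ℝ := polarTangent (levelRadius (bgmEffDisp β E h) μ) (sectorCenter n ω) with hτ
  set v : EuclideanSpace ℝ (Fin 2) := WithLp.toLp 2 τ with hv
  obtain ⟨S, hSR, hmem⟩ := exists_matsubara_box_tan hβpos (8 * e₀ * (4 : ℝ) ^ h)
  have hpFi : ∀ i, |(levelRadius (bgmEffDisp β E h) μ (sectorCenter n ω) • dir (sectorCenter n ω)) i| < π / 4 :=
    abs_fermiPoint_apply_lt hI hS hh₁ hh₀ hU hUh he hgap hgap' he4 hδ₁ _
  rw [bgmGenProp_eq_sum hI hSy hS he hβpos hh₁ hh₀ hU hUh hK₀ hK₁ hK₂' n ω x₀ x hmem, norm_mul,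
    Complex.norm_real, Real.norm_eq_abs, abs_of_pos (by positivity : (0 : ℝ) < 1 / β)]
  -- the sup bound of the tangential derivative of each slice
  have hM : ∀ (j' : ℤ) (y : EuclideanSpace ℝ (Fin 2)),
      ‖iteratedFDeriv ℝ N (bgmSliceE2 μ e₀ E h n ω (fermiMatsubara β j')) y (fun _ => v)‖ ≤
        Ks * ((4 : ℝ) ^ (-h) * (((2 : ℝ) ^ h) ^ min N 2 * ((4 : ℝ) ^ (-h)) ^ N)) := fun j' y =>
    hKs β U hβ E hβpos hI hSy hS hU hUh hK₀ hK₁ hK₂' hgap hgap' hδ₁ h hh₁ hh₀ ω j' y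
  have hdot : dot2 (WithLp.ofLp v) (fun i => (x i : ℝ)) = dot2 (fun i => (x i : ℝ)) τ := by
    rw [hv, WithLp.ofLp_toLp]
    simp only [dot2]
    ring
  -- each slice: `|x'₂|^N ‖S_j‖ ≤ KL w_n (2^h)^{min N 2} (4^{-h})^N`
  have hterm : ∀ j' ∈ S, |dot2 (fun i => (x i : ℝ)) τ| ^ N *
      ‖Complex.exp (-(Complex.I * ((π * (2 * (j' : ℝ) + 1) / β * x₀ : ℝ) : ℂ))) •
        ((∫ k in zoneSq, Complex.exp (-(Complex.I * ((dot2 k (fun i => (x i : ℝ)) : ℝ) : ℂ))) *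
          (((bgmSectorFn e₀ μ E h n ω
              (fermiMatsubara β j', k + levelRadius (bgmEffDisp β E h) μ (sectorCenter n ω) •
                dir (sectorCenter n ω)) : ℝ) : ℂ) /
            bgmDenom μ E (h - 1)
              (fermiMatsubara β j', k + levelRadius (bgmEffDisp β E h) μ (sectorCenter n ω) •
                dir (sectorCenter n ω)))) /
          (((2 * π) ^ 2 : ℝ) : ℂ))‖ ≤
        KL * sectorWidth n * ((2 : ℝ) ^ h) ^ min N 2 * ((4 : ℝ) ^ (-h)) ^ N / (2 * π) ^ 2 := by
    intro j' _
    rw [norm_smul, Literature.Analysis.Fourier.norm_cexp_neg_I_mul_ofReal, one_mul, norm_div, Complex.norm_real,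
      Real.norm_eq_abs, abs_of_pos (by positivity : (0 : ℝ) < (2 * π) ^ 2), ← mul_div_assoc]
    refine div_le_div_of_nonneg_right ?_ (by positivity)
    have h1 := pow_dot_mul_norm_sliceIntegral_le hI hS he he4 hh₁ hh₀ hU hUh hμ₁ hK₀ hgap hgap' hpFi n ω j'
      (fun i => (x i : ℝ)) v N
    rw [hdot] at h1
    refine h1.trans ?_
    refine (integral_norm_iteratedFDeriv_bgmSliceE2_le_of_bound hI hS he he4 hh₁ hh₀ hU hUh hμ₁ hK₀ hgap hgap'
      hδ₁ n hω j' N v (by positivity) (hM j')).trans (le_of_eq ?_)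
    have hc0 : Real.sqrt ((μ + 4 - e₀) / 2) ≠ 0 := by rw [← hc]; exact hcpos.ne'
    have hinv : (4 : ℝ) ^ (-h) * (4 : ℝ) ^ h = 1 := by rw [zpow_neg, inv_mul_cancel₀ h4.ne']
    calc 6 * (3 * sectorWidth n / 4) * (π / 4 * (Ks * ((4 : ℝ) ^ (-h) * (((2 : ℝ) ^ h) ^ min N 2 *
          ((4 : ℝ) ^ (-h)) ^ N))) * (2 * (e₀ * (4 : ℝ) ^ h / (2 / π * Real.sqrt ((μ + 4 - e₀) / 2)))))
        = 6 * (3 / 4) * (π / 4) * Ks * (2 * (e₀ / (2 / π * Real.sqrt ((μ + 4 - e₀) / 2)))) * sectorWidth n *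
            ((2 : ℝ) ^ h) ^ min N 2 * ((4 : ℝ) ^ (-h)) ^ N * ((4 : ℝ) ^ (-h) * (4 : ℝ) ^ h) := by
          field_simp
      _ = KL * sectorWidth n * ((2 : ℝ) ^ h) ^ min N 2 * ((4 : ℝ) ^ (-h)) ^ N := by
          rw [hinv, mul_one, hKL, hc]
  have hβS := inv_beta_mul_card_le_tan hβpos (by positivity) S hSR
  -- sum up
  have hsum : |dot2 (fun i => (x i : ℝ)) τ| ^ N *
      ‖∑ j' ∈ S, Complex.exp (-(Complex.I * ((π * (2 * (j' : ℝ) + 1) / β * x₀ : ℝ) : ℂ))) •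
        ((∫ k in zoneSq, Complex.exp (-(Complex.I * ((dot2 k (fun i => (x i : ℝ)) : ℝ) : ℂ))) *
          (((bgmSectorFn e₀ μ E h n ω
              (fermiMatsubara β j', k + levelRadius (bgmEffDisp β E h) μ (sectorCenter n ω) •
                dir (sectorCenter n ω)) : ℝ) : ℂ) /
            bgmDenom μ E (h - 1)
              (fermiMatsubara β j', k + levelRadius (bgmEffDisp β E h) μ (sectorCenter n ω) •
                dir (sectorCenter n ω)))) /
          (((2 * π) ^ 2 : ℝ) : ℂ))‖ ≤
      S.card * (KL * sectorWidth n * ((2 : ℝ) ^ h) ^ min N 2 * ((4 : ℝ) ^ (-h)) ^ N / (2 * π) ^ 2) := by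
    refine (mul_le_mul_of_nonneg_left (norm_sum_le _ _) (by positivity)).trans ?_
    rw [Finset.mul_sum]
    refine (Finset.sum_le_sum hterm).trans (le_of_eq ?_)
    rw [Finset.sum_const, nsmul_eq_mul]
  have hxN : ((4 : ℝ) ^ h * |dot2 (fun i => (x i : ℝ)) τ|) ^ N =
      ((4 : ℝ) ^ h) ^ N * |dot2 (fun i => (x i : ℝ)) τ| ^ N := mul_pow _ _ _
  rw [hxN]
  have hNN : ((4 : ℝ) ^ h) ^ N * ((4 : ℝ) ^ (-h)) ^ N = 1 := by
    rw [← mul_pow, zpow_neg, mul_inv_cancel₀ h4.ne', one_pow]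
  calc ((4 : ℝ) ^ h) ^ N * |dot2 (fun i => (x i : ℝ)) τ| ^ N * (1 / β * ‖∑ j' ∈ S, _‖)
      = ((4 : ℝ) ^ h) ^ N * (1 / β) * (|dot2 (fun i => (x i : ℝ)) τ| ^ N * ‖∑ j' ∈ S, _‖) := by ring
    _ ≤ ((4 : ℝ) ^ h) ^ N * (1 / β) * (S.card * (KL * sectorWidth n * ((2 : ℝ) ^ h) ^ min N 2 *
          ((4 : ℝ) ^ (-h)) ^ N / (2 * π) ^ 2)) := mul_le_mul_of_nonneg_left hsum (by positivity)
    _ = (((4 : ℝ) ^ h) ^ N * ((4 : ℝ) ^ (-h)) ^ N) * (1 / β * S.card) *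
          (KL * sectorWidth n * ((2 : ℝ) ^ h) ^ min N 2 / (2 * π) ^ 2) := by ring
    _ ≤ 1 * (4 * (8 * e₀ * (4 : ℝ) ^ h) / π) *
          (KL * sectorWidth n * ((2 : ℝ) ^ h) ^ min N 2 / (2 * π) ^ 2) := by
        rw [hNN]; gcongr
    _ = 32 * e₀ / π * KL / (2 * π) ^ 2 * (4 : ℝ) ^ h * sectorWidth n * ((2 : ℝ) ^ h) ^ min N 2 := by ring

/-! ### §3 Assembly: Lemma 2.2 -/

/-- `|x⃗·n⃗| ≤ |x⃗|` for the unit normal of a polar curve with `u(θ) > 0`. [cite: BenfattoGiulianiMastropietro2006, §2.5 (2.46)–(2.47) p0010:L55–L64] -/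
private theorem abs_dot2_polarNormal_le_sqrt {u : ℝ → ℝ} {θ : ℝ} (hu : 0 < u θ) (w : Fin 2 → ℝ) :
    |dot2 w (polarNormal u θ)| ≤ Real.sqrt (w 0 ^ 2 + w 1 ^ 2) := by
  refine Real.abs_le_sqrt ?_
  have h := dot2_polarNormal_sq_add_dot2_polarTangent_sq u θ hu w
  nlinarith [sq_nonneg (dot2 w (polarTangent u θ))]

/-- **Lemma 2.2 of BGM06, (2.52)** — the decay of the anisotropic single-scale sector propagators
`g^{(h)}_ω` for the scale-dependent dispersion:
`|g^{(h)}_ω(x)| ≤ C_N γ^{3h/2} / (1 + (γ^h|d_β(x₀)| + γ^h|x'₁|)^N + γ^{-h}(γ^h|x'₂|)^N)` for `N ≥ 2`,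
`x'₁ = x⃗·n⃗_h(θ_{h,ω})`, `x'₂ = x⃗·τ⃗_h(θ_{h,ω})`, uniformly in `β, U, h, ω` — the `k₀`/`k'₁` sides in
the isotropic normal form of `exists_decay_bgmGenProp` at the anisotropic index (`γ^h w_n = πγ^{3h/2}`,
`|x'₁| ≤ |x⃗|`), plus the tangential decay of §2 (for `N ≥ 2`, `(γ^{h/2})^{min(N,2)} = γ^h`).
[cite: BenfattoGiulianiMastropietro2006, §2.5 Lemma 2.2 (2.51)–(2.52) p0010:L107–L120 and its proof p0010:L129–p0011:L22] -/
theorem BGM2006_Lemma_2_2_holds : BGM2006_Lemma_2_2 := by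
  intro μ e₀ hμ₁ _ he₀ C N hN
  have he : 0 < e₀ := he₀.1
  have he4 : e₀ < μ + 4 := he₀.2.2
  have hπ := Real.pi_pos
  have hc'0 : 0 < Real.sqrt ((μ + 4 - e₀) / 2) := Real.sqrt_pos.2 (by linarith)
  -- the two inputs: the isotropic normal form (all angular indices) and the tangential decay
  obtain ⟨c₁, K₁, hc₁, hK₁0, hiso⟩ := exists_decay_bgmGenProp hμ₁ he₀ C N
  obtain ⟨c₂, hc₂, hK₀, hK₁, hK₂', hgap, hgap', hδ₁⟩ := exists_coupledSmallness he₀ C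
  obtain ⟨K₂, hK₂0, htan⟩ := exists_tanpow_mul_norm_bgmGenProp_le hμ₁ he he4 C N c₂
  refine ⟨min c₁ c₂, K₁ * π + K₂ * π, lt_min hc₁ hc₂,
    fun β U₀ U hβ hβpos hhβ hU hc E hI hSy hS h hh₁ hh₀ ω hω x₀ x => ?_⟩
  have hcle₁ : |(hβ : ℝ)| * U₀ ≤ c₁ := hc.trans (min_le_left _ _)
  have hcle₂ : |(hβ : ℝ)| * U₀ ≤ c₂ := hc.trans (min_le_right _ _)
  obtain ⟨U', hS', hU', hUh'⟩ := bgmSmoothness_wlog hS hhβ hU hcle₂ hc₂.le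
  have h4 : (0 : ℝ) < (4 : ℝ) ^ h := zpow_pos (by norm_num) _
  have h4' : (0 : ℝ) < (4 : ℝ) ^ (-h) := zpow_pos (by norm_num) _
  have h2 : (0 : ℝ) < (2 : ℝ) ^ h := zpow_pos (by norm_num) _
  -- scale arithmetic: `w_n = π 2^h ≥ 4^h`, `(2^h)^2 = 4^h`, `4^h 2^h = 2^{3h}`
  have hwidth : sectorWidth (bgmScaleIdx h) = π * (2 : ℝ) ^ h := sectorWidth_bgmScaleIdx hh₀
  have h4sq : (4 : ℝ) ^ h = ((2 : ℝ) ^ h) ^ 2 := by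
    rw [show (4 : ℝ) = 2 ^ 2 by norm_num, ← zpow_natCast, ← zpow_mul, ← zpow_natCast, ← zpow_mul]; ring_nf
  have hσ1 : (2 : ℝ) ^ h ≤ 1 := zpow_le_one_of_nonpos₀ (by norm_num) hh₀
  have h42 : (4 : ℝ) ^ h ≤ (2 : ℝ) ^ h := by rw [h4sq, sq]; exact mul_le_of_le_one_left h2.le hσ1
  have hwm : (4 : ℝ) ^ h ≤ sectorWidth (bgmScaleIdx h) := by
    rw [hwidth]
    have : (1 : ℝ) * (2 : ℝ) ^ h ≤ π * (2 : ℝ) ^ h :=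
      mul_le_mul_of_nonneg_right (by linarith [Real.pi_gt_three]) h2.le
    linarith
  have hmin : ((2 : ℝ) ^ h) ^ min N 2 = (4 : ℝ) ^ h := by rw [min_eq_right hN, h4sq]
  have h232 : (4 : ℝ) ^ h * (2 : ℝ) ^ h = (2 : ℝ) ^ (3 * h) := by
    rw [h4sq, show (3 : ℤ) * h = h + h + h by ring, zpow_add₀ (by norm_num : (2 : ℝ) ≠ 0),
      zpow_add₀ (by norm_num : (2 : ℝ) ≠ 0)]
    ring
  have h8 : (0 : ℝ) < (2 : ℝ) ^ (3 * h) := zpow_pos (by norm_num) _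
  -- the two bounds
  have hb₁ := hiso β U₀ U hβ hβpos hhβ hU hcle₁ E hI hSy hS h hh₁ hh₀ (bgmScaleIdx h) ω hω hwm x₀ x
  have hb₂ := htan β U' hβ E hβpos hI hSy hS' hU' hUh' hK₀ hK₁ hK₂' hgap hgap' hδ₁ h hh₁ hh₀ ω hω x₀ x
  rw [hmin, hwidth] at hb₂
  rw [hwidth] at hb₁
  -- the frame: `|x'₁| ≤ |x⃗|`
  obtain ⟨-, hcu, -, -, -, -⟩ := fermiCurve_data hI hS' hh₁ hh₀ hU' hUh' he hgap hgap' he4 hδ₁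
    (sectorCenter (bgmScaleIdx h) ω)
  have hupos : 0 < levelRadius (bgmEffDisp β E h) μ (sectorCenter (bgmScaleIdx h) ω) := hc'0.trans_le hcu
  -- names
  show ‖bgmGenProp β e₀ μ E h (bgmScaleIdx h) ω x₀ x‖ ≤ _
  obtain ⟨g, hg⟩ : ∃ g : ℝ, g = ‖bgmGenProp β e₀ μ E h (bgmScaleIdx h) ω x₀ x‖ := ⟨_, rfl⟩
  have hg0 : 0 ≤ g := by rw [hg]; exact norm_nonneg _
  obtain ⟨a, ha⟩ : ∃ a : ℝ, a = (4 : ℝ) ^ h * |bgmDbeta β x₀| := ⟨_, rfl⟩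
  obtain ⟨r, hr⟩ : ∃ r : ℝ, r = (4 : ℝ) ^ h * Real.sqrt (((x 0 : ℝ)) ^ 2 + ((x 1 : ℝ)) ^ 2) := ⟨_, rfl⟩
  obtain ⟨b, hb⟩ : ∃ b : ℝ, b = (4 : ℝ) ^ h * |dot2 (fun i => (x i : ℝ))
      (polarNormal (levelRadius (bgmEffDisp β E h) μ) (sectorCenter (bgmScaleIdx h) ω))| := ⟨_, rfl⟩
  obtain ⟨t, ht⟩ : ∃ t : ℝ, t = (4 : ℝ) ^ h * |dot2 (fun i => (x i : ℝ))
      (polarTangent (levelRadius (bgmEffDisp β E h) μ) (sectorCenter (bgmScaleIdx h) ω))| := ⟨_, rfl⟩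
  have ha0 : 0 ≤ a := by rw [ha]; positivity
  have hb0 : 0 ≤ b := by rw [hb]; positivity
  have ht0 : 0 ≤ t := by rw [ht]; positivity
  have hr0 : 0 ≤ r := by rw [hr]; positivity
  have hbr : b ≤ r := by
    rw [hb, hr]
    exact mul_le_mul_of_nonneg_left (abs_dot2_polarNormal_le_sqrt hupos _) h4.le
  rw [← hg, ← ha, ← hr] at hb₁
  rw [← hg, ← ht] at hb₂
  rw [← hg, ← ha, ← hb, ← ht]
  -- the isotropic normal form: `g (1 + (a + r)^N) ≤ K₁ π 2^{3h}`
  have hD₁ : 0 < 1 + (a + r) ^ N := by positivity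
  have hb₁' : g * (1 + (a + r) ^ N) ≤ K₁ * π * (2 : ℝ) ^ (3 * h) := by
    have := (le_div_iff₀ hD₁).1 hb₁
    calc g * (1 + (a + r) ^ N) ≤ K₁ * (4 : ℝ) ^ h * (π * (2 : ℝ) ^ h) := this
      _ = K₁ * π * ((4 : ℝ) ^ h * (2 : ℝ) ^ h) := by ring
      _ = K₁ * π * (2 : ℝ) ^ (3 * h) := by rw [h232]
  -- the tangential decay: `4^{-h} t^N g ≤ K₂ π 2^{3h}`
  have hb₂' : (4 : ℝ) ^ (-h) * t ^ N * g ≤ K₂ * π * (2 : ℝ) ^ (3 * h) := by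
    have hinv : (4 : ℝ) ^ (-h) * (4 : ℝ) ^ h = 1 := by rw [zpow_neg, inv_mul_cancel₀ h4.ne']
    calc (4 : ℝ) ^ (-h) * t ^ N * g = (4 : ℝ) ^ (-h) * (t ^ N * g) := by ring
      _ ≤ (4 : ℝ) ^ (-h) * (K₂ * (4 : ℝ) ^ h * (π * (2 : ℝ) ^ h) * (4 : ℝ) ^ h) :=
          mul_le_mul_of_nonneg_left hb₂ h4'.le
      _ = K₂ * π * ((4 : ℝ) ^ h * (2 : ℝ) ^ h) * ((4 : ℝ) ^ (-h) * (4 : ℝ) ^ h) := by ring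
      _ = K₂ * π * (2 : ℝ) ^ (3 * h) := by rw [hinv, mul_one, h232]
  -- combine
  have hD : 0 < 1 + (a + b) ^ N + (4 : ℝ) ^ (-h) * t ^ N := by positivity
  rw [le_div_iff₀ hD]
  have hpow : (a + b) ^ N ≤ (a + r) ^ N := pow_le_pow_left₀ (by positivity) (by linarith) N
  calc g * (1 + (a + b) ^ N + (4 : ℝ) ^ (-h) * t ^ N)
      = g * (1 + (a + b) ^ N) + (4 : ℝ) ^ (-h) * t ^ N * g := by ring
    _ ≤ g * (1 + (a + r) ^ N) + (4 : ℝ) ^ (-h) * t ^ N * g := by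
        have := mul_le_mul_of_nonneg_left (add_le_add_left hpow 1) hg0
        linarith
    _ ≤ K₁ * π * (2 : ℝ) ^ (3 * h) + K₂ * π * (2 : ℝ) ^ (3 * h) := add_le_add hb₁' hb₂'
    _ = (K₁ * π + K₂ * π) * (2 : ℝ) ^ (3 * h) := by ring

end Literature.MathematicalPhysics.QuantumLattice.FermiRG

end
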